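import Literature.Barriers.AtomisticToContinuum.AnticontinuumLocalizationZeroSet
import Literature.Probability.Distributions.GaussianSlabs
import HarnessLib

/-!
# De Roeck–Huveneers 2015, Lemma 4 (second claim) for the rotor chain: the Gaussian measure of `Z` and `Z₁`

`Literature/Barriers/AtomisticToContinuum/` — the measure estimates for the resonant sets of
`AnticontinuumLocalizationZeroSet.lean` under the product Gaussian `⊗ᵐ𝒩(0, v)`, from the slab
estimate of `Literature/Probability/Distributions/GaussianSlabs.lean`, PROVED:

* `measure_Z1set_le`: `⊗ᵐ𝒩(0,v)(Z₁(η)) ≤ C η` (finite union of single slabs; the `C'' δ` of §5.6);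
* `measure_Zset_le`: `⊗ᵐ𝒩(0,v)(Z(η)) ≤ C η^{n₂}` (finite union of `n₂`-fold independent slab
  systems — Lemma 4, second claim: "`⟨χ_Z⟩_T ≤ C δ^{n₂}`", here with `η = L^{n₂+1}δ`).

The constants depend on the window and the radii but not on `η`.
-/

noncomputable section

open MeasureTheory ProbabilityTheory Function Set Finset Filter
open scoped ENNReal NNReal BigOperators Topology

namespace Literature.Barriers.AtomisticToContinuum.HeatConduction.RotorChain

open Literature.MathematicalPhysics.KineticTheory.HeatConduction Literature.Probability.Distributions

variable {m : ℕ}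

/-- `k·ω = modeVec k ⬝ ω`. [folklore] -/
theorem modeFreq_eq_dotProduct (k : Fin m → ℤ) (w : Fin m → ℝ) : modeFreq k w = modeVec k ⬝ᵥ w := rfl

/-- A nonzero integer mode gives a nonzero real vector. [folklore] -/
theorem modeVec_ne_zero {k : Fin m → ℤ} (hk : k ≠ 0) : modeVec k ≠ 0 := by
  intro h
  apply hk
  funext y
  have := congr_fun h y
  simp only [modeVec, Pi.zero_apply, Int.cast_eq_zero] at this
  exact this

/-- **`⊗ᵐ𝒩(0,v)(Z₁(η)) ≤ C η`.** [cite: DeRoeckHuveneers2015, §5.6 ("`≤ C' ∫ χ_W(ω) ∏ e^{-ω_x²/2T} dω_x ≤ C'' δ`, where, to get the last inequality, we used that, for any `(ω,q) ∈ W`, there is at least one `k ∈ K_r` … such that `|ω·k| ≤ L^{n₂+1}δ`")] -/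
theorem measure_Z1set_le (m r : ℕ) (b : Fin m) (R₁ : ℕ) {v : ℝ≥0} (hv : v ≠ 0) :
    ∃ C : ℝ, 0 ≤ C ∧ ∀ η : ℝ, 0 ≤ η →
      (Measure.pi fun _ : Fin m => gaussianReal 0 v) (Z1set m r b R₁ η) ≤ ENNReal.ofReal (C * η) := by
  classical
  set μ : Measure (Fin m → ℝ) := Measure.pi fun _ : Fin m => gaussianReal 0 v with hμ
  have hC : ∀ k : Fin m → ℤ, ∃ C : ℝ, 0 ≤ C ∧ (k ≠ 0 → ∀ η : ℝ, 0 ≤ η →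
      μ (slabs (fun _ : Fin 1 => modeVec k) η) ≤ ENNReal.ofReal (C * η ^ 1)) := by
    intro k
    by_cases hk : k = 0
    · exact ⟨0, le_rfl, fun h => absurd hk h⟩
    · have hli : LinearIndependent ℝ (fun _ : Fin 1 => modeVec k) := linearIndependent_unique_iff.2 (modeVec_ne_zero hk)
      obtain ⟨C, hC0, hCb⟩ := pi_gaussianReal_slabs_le hli hv
      exact ⟨C, hC0, fun _ => hCb⟩
  choose Cf hCf0 hCf using hC
  set T : Finset (Fin m → ℤ) := ((finite_boundedModes m r).subset (fun k (hk : IsKMode r k ∧ ModeNear b R₁ k) => hk.1.2.1)).toFinset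
    with hT
  refine ⟨∑ k ∈ T, Cf k, Finset.sum_nonneg fun k _ => hCf0 k, fun η hη => ?_⟩
  have hsub : Z1set m r b R₁ η ⊆ ⋃ k ∈ T, slabs (fun _ : Fin 1 => modeVec k) η := by
    intro w hw
    obtain ⟨k, hk, hn, hkw⟩ := hw
    refine Set.mem_iUnion₂.2 ⟨k, ?_, ?_⟩
    · rw [hT, Set.Finite.mem_toFinset]; exact ⟨hk, hn⟩
    · intro j; rw [← modeFreq_eq_dotProduct]; exact hkw
  calc μ (Z1set m r b R₁ η) ≤ μ (⋃ k ∈ T, slabs (fun _ : Fin 1 => modeVec k) η) := measure_mono hsub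
    _ ≤ ∑ k ∈ T, μ (slabs (fun _ : Fin 1 => modeVec k) η) := measure_biUnion_finset_le _ _
    _ ≤ ∑ k ∈ T, ENNReal.ofReal (Cf k * η) := by
        refine Finset.sum_le_sum fun k hk => ?_
        rw [hT, Set.Finite.mem_toFinset] at hk
        have := hCf k hk.1.1 η hη
        rwa [pow_one] at this
    _ = ENNReal.ofReal ((∑ k ∈ T, Cf k) * η) := by
        rw [Finset.sum_mul, ENNReal.ofReal_sum_of_nonneg fun k _ => mul_nonneg (hCf0 k) hη]

/-- **Lemma 4, second claim: `⊗ᵐ𝒩(0,v)(Z(η)) ≤ C η^{n₂}`.** [cite: DeRoeckHuveneers2015, §5.5 Lemma 4, second claim ("`⟨χ_Z⟩_T ≤ C δ^{n₂}`"; "a straightforward computation that exploits that the set `Z` is determined by `n₂` constraints")] -/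
theorem measure_Zset_le (m r n₂ : ℕ) (b : Fin m) (Rz : ℕ) {v : ℝ≥0} (hv : v ≠ 0) :
    ∃ C : ℝ, 0 ≤ C ∧ ∀ η : ℝ, 0 ≤ η →
      (Measure.pi fun _ : Fin m => gaussianReal 0 v) (Zset m r n₂ b Rz η) ≤ ENNReal.ofReal (C * η ^ n₂) := by
  classical
  set μ : Measure (Fin m → ℝ) := Measure.pi fun _ : Fin m => gaussianReal 0 v with hμ
  have hC : ∀ ks : Fin n₂ → (Fin m → ℤ), ∃ C : ℝ, 0 ≤ C ∧ (LinearIndependent ℝ (fun j => modeVec (ks j)) → ∀ η : ℝ, 0 ≤ η →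
      μ (slabs (fun j => modeVec (ks j)) η) ≤ ENNReal.ofReal (C * η ^ n₂)) := by
    intro ks
    by_cases hli : LinearIndependent ℝ (fun j => modeVec (ks j))
    · obtain ⟨C, hC0, hCb⟩ := pi_gaussianReal_slabs_le hli hv
      exact ⟨C, hC0, fun _ => hCb⟩
    · exact ⟨0, le_rfl, fun h => absurd h hli⟩
  choose Cf hCf0 hCf using hC
  set T : Finset (Fin n₂ → (Fin m → ℤ)) := ((finite_boundedTuples m r n₂).subset
    (fun ks (hks : LinearIndependent ℝ (fun j => modeVec (ks j)) ∧ ∀ j, IsKMode r (ks j) ∧ ModeNear b Rz (ks j)) =>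
      fun j y => (hks.2 j).1.2.1 y)).toFinset with hT
  refine ⟨∑ ks ∈ T, Cf ks, Finset.sum_nonneg fun ks _ => hCf0 ks, fun η hη => ?_⟩
  have hsub : Zset m r n₂ b Rz η ⊆ ⋃ ks ∈ T, slabs (fun j => modeVec (ks j)) η := by
    intro w hw
    obtain ⟨ks, hli, hks⟩ := hw
    refine Set.mem_iUnion₂.2 ⟨ks, ?_, ?_⟩
    · rw [hT, Set.Finite.mem_toFinset]; exact ⟨hli, fun j => ⟨(hks j).1, (hks j).2.1⟩⟩
    · intro j; rw [← modeFreq_eq_dotProduct]; exact (hks j).2.2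
  calc μ (Zset m r n₂ b Rz η) ≤ μ (⋃ ks ∈ T, slabs (fun j => modeVec (ks j)) η) := measure_mono hsub
    _ ≤ ∑ ks ∈ T, μ (slabs (fun j => modeVec (ks j)) η) := measure_biUnion_finset_le _ _
    _ ≤ ∑ ks ∈ T, ENNReal.ofReal (Cf ks * η ^ n₂) := by
        refine Finset.sum_le_sum fun ks hks => ?_
        rw [hT, Set.Finite.mem_toFinset] at hks
        exact hCf ks hks.1 η hη
    _ = ENNReal.ofReal ((∑ ks ∈ T, Cf ks) * η ^ n₂) := by
        rw [Finset.sum_mul, ENNReal.ofReal_sum_of_nonneg fun ks _ => mul_nonneg (hCf0 ks) (pow_nonneg hη _)]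

end Literature.Barriers.AtomisticToContinuum.HeatConduction.RotorChain

end
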